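/-
Copyright (c) 2026 the pub-hodgecm-mathlib formalisation cell (harness21).  Prover seat hodgecm-mathlib-LH7-p10 (g2), req620 Track A «(D-RAM) FOUR-FRAME» squad
((β₂) road (R-36) «PURE-CELL LEDGER», lane C = type RamM: the twin of LH4-p13 (g9)'s ★ p862855 `F0P3cDyRamTopConeCellOffShell` for the `hTopC` socket of LH4-p12 (g8)'s ★
p863526 (OFF_C) dispatch), 2026-09-05.
-/
import Summits.HodgeConjecture.HodgeConjecture.Theorems.F0P3cDyRamShellLineModel           -- ★ p861579 (LH4-p16 (g0)): `latticeInLevel_endoGL_sub_one_sq_iff_isOrd` (the square token ⟺ three order clauses); brings ★ DEFS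
import HarnessLib

/-!
# Crux `H413`, line LH4 «(D-RAM) FOUR-FRAME» — the (β₂) road (R-36), lane C (type RamM): «ABOVE THE ROW THE SQUARE TOKEN FAILS» — on a cone cell `(j, b)` of the RamM
# ledger whose depth tokens satisfy `jl + m < 2j + d_ρ + 2b + 2k` (on the lane-C top line `jl + 2b = 2j + d_ρ + m`: `m < 2b + k`) EVERY glued vertex has `(Γ − 1)²·L ⊄ ϖ^k·L`,
# so it lies on NO `(ℓ, k)` near-transvection shell (any `q`, any `d`, any `ℓ`)

Cell `hodgecm-mathlib` (D-0151), FLOOR 0, crux item H413 = `stmt-HodgeConjecture-24833`, route of record `HCCMUnconditional`; squads F0∕P3c∕LH4 + LH7; lane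
`--supports stmt-HodgeConjecture-24833 --as helper` (count-neutral; pays NO tier-0 row).  THEOREMS ONLY (no `def`, no instance, no notation, no `sorry`, default heartbeats);
★-only imports; states NO law; (β₂) stays a HYPOTHESIS.  DATUM-FREE: plane field `E` with `|ϖ| = exp(−1)`, line model `(M, jE, ρ, α)` (`ρ` isometric, `ρ` fixes `jE(E)`), `jE`
RAMIFIED (`|jE ϖ| = exp(−2)`, `|α − ρα| = exp(−d_ρ)` — the two letters that replace lane B's `|jE a| = |a|`, `|α − ρα| = 1`), a glued vertex `L` with tube `b` over `Λ = φ(B₂) = x₀·𝒪_cc`,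
`φ w₀ = Y⁻¹x₀` (★ `…ShellLineModel` letters VERBATIM), `cc = (jE ϖ)^j`.  NO residue field, NO `|2|`, NO `σ`, NO `Θ`.

WHY (LH4-p12 (g8)'s lane-C (OFF_C) dispatch ★ p863526 `cellDiff_offRowC_eq_zero_of_pieces`, socket `hTopC : ∀ j b, 1 ≤ b → b ≤ j → m < 4b → jl + 2b = 2j + dρ + m → ‹live› →
lam ∈ 𝒪_j → cellDiff(j,b) = 0`; this seat's ✋ 00:25:10Z).  THIS FILE is LH4-p13 (g9)'s ★ p862855 with the digit RE-DERIVED IN v_M UNITS: the depth tokens of ‹OFF_C.letter.v2› are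
`|μ| = exp(−m)`, `|μ − ρμ| = exp(−jl)` (`μ = lam − jE u₀₀`, valuations of `M`), the cell indices `(j, b)` and the shell level `k` are E-levels (`|jE ϖ^j| = exp(−2j)`, `|Y| = exp(−2b)`,
`|jE ϖ^k| = exp(−2k)`), and `|cc·(α − ρα)| = exp(−(2j + d_ρ))`.  The third clause of the square token of ★ `…ShellLineModel.latticeInLevel_endoGL_sub_one_sq_iff_isOrd` asks
`w := ((lam − 1)² − (jE u₀₀ − 1)²)∕(jE ϖ^k·Y) = z₀·ν∕jE ϖ^k ∈ 𝒪_cc` (`z₀ = μ∕Y`, `ν := (lam − 1) + (jE u₀₀ − 1)`, `ν − ρν = μ − ρμ`); in `w − ρw = ((z₀ − ρz₀)·ν + ρz₀·(ν − ρν))∕jE ϖ^k` the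
second term has size EXACTLY `exp(−m + 2b − jl + 2k)`, the first at most `exp(−2j − d_ρ)` once `|ν| ≤ |jE ϖ|^k`; so when `jl + m < 2j + d_ρ + 2b + 2k` the second term beats both the
first and the order's bound `exp(−(2j + d_ρ))` — the square token FAILS and the vertex is on no `(ℓ, k)`-shell.
* §1 `not_isOrd_mul_div_of_top_ramM` — THE DIGIT: `¬ IsOrd ρ α (P^j) (μ·ν ∕ (P^k·Y))` from the size letters and `jl + m < 2j + d_ρ + 2b + 2k` (`P = jE ϖ`).
* §2 HEADS `not_latticeInLevel_sq_endoGL_sub_one_of_top_ramM` (`¬ LatticeInLevel ϖ k ((Γ − 1)·(Γ − 1)) L`) and `not_latticeNearTransvShell_of_top_ramM` (`∀ ℓ, ¬ LatticeNearTransvShell ϖ ℓ k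
  (Γ − 1) L`), in ★ `…ShellLineModel`'s glued-vertex letters + `hYb`, `hz : IsOrd cc (μ∕Y)`, the tokens `hm hjl`, `hjϖ`, `hαρ`, `hν : |ν| ≤ |jE ϖ|^k`, `htop`.
WHAT IS NOT CLAIMED.  Which top cells are populated; the band `2b + k ≤ m` (there the square token can hold: the balanced «UPPER LINE»); `|ν| ≤ |jE ϖ|^k` is a letter (the consumer
reads it off `2k ≤ m` and `|2·(u₀₀ − 1)|² ≤ |jE ϖ|^k`); any census law.
HONEST LABEL.  Count-neutral valuation algebra; nothing printed is asserted; `HC_CM` is proved only modulo the 7 printed citations (2 remaining named inputs: hLiu418 =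
`stmt-HodgeConjecture-24832`, h413 = `stmt-HodgeConjecture-24833`) until rung 0 closes.
## References
* [Serre1979] J.-P. Serre, *Local Fields*, GTM 67 (1979): Ch. III §6 Prop. 12 (orders of conductor `c`).
* [Kottwitz1986BaseChangeUnits] R. E. Kottwitz, *Base change for unit elements of Hecke algebras*, Compositio Math. 60 (1986): §1 pp. 240–241 (congruence-level pieces as lattice conditions).
* [Jacobowitz1962] R. Jacobowitz, *Hermitian forms over local fields*, Amer. J. Math. 84 (1962): §4 (duals, gluing).
* [Rogawski1990] J. D. Rogawski, *Automorphic Representations of Unitary Groups in Three Variables*, Ann. of Math. Stud. 123 (1990): §4.9 Prop. 4.9.1 (b) p. 55.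
-/

set_option autoImplicit false

noncomputable section

namespace Summit.HodgeConjecture.HodgeConjecture.Cruxes.H413.F0P3cDyRamTopConeCellOffShellRamM

open scoped Valued WithZero Matrix MatrixGroups
open WithZero
open Literature.NumberTheory.Automorphic Literature.NumberTheory.Automorphic.HermitianLattice Literature.NumberTheory.Automorphic.UnitaryLatticeTree
open Literature.NumberTheory.Rogawski1990
open Summit.HodgeConjecture.HodgeConjecture.Cruxes.H413.F0P3cDyRamToricCensusDefs
open Summit.HodgeConjecture.HodgeConjecture.Cruxes.H413.F0P3cDyRamFourFrameCensusDefs (LatticeInLevel LatticeNearTransvShell)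
open Summit.HodgeConjecture.HodgeConjecture.Cruxes.H413.F0P3cDyRamShellLineModel (latticeInLevel_endoGL_sub_one_sq_iff_isOrd)

variable {E M : Type} [Field E] [Valued E ℤᵐ⁰] [Field M] [Valued M ℤᵐ⁰] {ρ : M →+* M} {α : M}

/-! ## §1 The digit: above the row the third clause of the square token fails -/

/-- **THE DIGIT, RamM LANE — «ABOVE THE ROW THE SQUARE TOKEN FAILS» (any `q`, any `d`).**  Line model: `ρ` isometric, `ρP = P`, `|P| = exp(−2)` (`P = jE ϖ`: the E-uniformiser read in the
ramified `M`), `|α − ρα| = exp(−d_ρ)`.  SIZE LETTERS (v_M units): `|Y| = |P|^b` (the cell's E-level), `|μ| = exp(−m)`, `|μ − ρμ| = exp(−jl)` (the key's depth tokens of ‹OFF_C›),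
the DEPTH CLAUSE `|μ∕Y − ρ(μ∕Y)| ≤ |P^j·(α − ρα)|` of the cone cell `(j, b)`, and an element `ν` with `ν − ρν = μ − ρμ`, `|ν| ≤ |P|^k`.  IF `jl + m < 2j + d_ρ + 2b + 2k` THEN
`μ·ν∕(P^k·Y) ∉ 𝒪_{P^j}`: in `μν∕(P^k Y) − ρ(μν∕(P^k Y)) = ((μ∕Y − ρ(μ∕Y))·ν + ρ(μ∕Y)·(ν − ρν))∕P^k` the second summand has size `exp(−m + 2b − jl) > exp(−2j − d_ρ − 2k)` and
dominates the first (lane B, ★ `not_isOrd_mul_div_of_top`: `jl + m < j + b + k` at `|P| = exp(−1)`, `|α − ρα| = exp κ`). [cite: Serre1979, Ch. III §6 Prop. 12] [cite: Kottwitz1986BaseChangeUnits, §1 pp. 240–241] -/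
theorem not_isOrd_mul_div_of_top_ramM (hvρ : ∀ x, Valued.v (ρ x) = Valued.v x)
    {P : M} (hρP : ρ P = P) (hP : Valued.v P = exp (-2 : ℤ))
    {Y μ ν : M} {j b m jl k dρ : ℕ}
    (hYb : Valued.v Y = Valued.v P ^ b) (hμ : Valued.v μ = exp (-(m : ℤ))) (hjl : Valued.v (μ - ρ μ) = exp (-(jl : ℤ)))
    (hαρ : Valued.v (α - ρ α) = exp (-(dρ : ℤ)))
    (hz : Valued.v (μ / Y - ρ (μ / Y)) ≤ Valued.v (P ^ j * (α - ρ α)))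
    (hνρ : ν - ρ ν = μ - ρ μ) (hν : Valued.v ν ≤ Valued.v P ^ k) (htop : jl + m < 2 * j + dρ + 2 * b + 2 * k) :
    ¬ IsOrd ρ α (P ^ j) (μ * ν / (P ^ k * Y)) := by
  intro hO
  have h2 := ((isOrd_iff _ _ _ _).1 hO).2
  -- non-vanishing bookkeeping
  have hvP0 : Valued.v P ≠ 0 := by rw [hP]; exact exp_ne_zero
  have hP0 : P ≠ 0 := fun h0 => hvP0 (by rw [h0, map_zero])
  have hPk0 : P ^ k ≠ 0 := pow_ne_zero k hP0
  have hY0 : Y ≠ 0 := fun h0 => by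
    rw [h0, map_zero] at hYb
    exact pow_ne_zero b hvP0 hYb.symm
  have hρY0 : ρ Y ≠ 0 := (map_ne_zero ρ).2 hY0
  -- every size as `exp` of an integer (`|P|^n = exp(−2n)`)
  have hPn : ∀ n : ℕ, Valued.v P ^ n = exp (-(2 * (n : ℤ))) := fun n => by
    rw [hP, ← exp_nsmul]; congr 1; simp only [nsmul_eq_mul]; ring
  -- the identity
  have e : μ * ν / (P ^ k * Y) - ρ (μ * ν / (P ^ k * Y)) = ((μ / Y - ρ (μ / Y)) * ν + ρ (μ / Y) * (ν - ρ ν)) / P ^ k := by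
    rw [map_div₀, map_mul, map_mul, map_pow, hρP, map_div₀]
    field_simp
    ring
  -- sizes of the two summands
  have hT2 : Valued.v (ρ (μ / Y) * (ν - ρ ν)) = exp (-(m : ℤ) + 2 * b + -(jl : ℤ)) := by
    rw [map_mul, hvρ, map_div₀, hμ, hYb, hνρ, hjl, hPn, ← exp_sub, ← exp_add]
    congr 1; ring
  have hT1 : Valued.v ((μ / Y - ρ (μ / Y)) * ν) ≤ exp (-(2 * (j : ℤ)) + -(dρ : ℤ) + -(2 * (k : ℤ))) := by
    rw [map_mul, exp_add]
    refine mul_le_mul' ?_ (hν.trans_eq (hPn k))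
    calc Valued.v (μ / Y - ρ (μ / Y)) ≤ Valued.v (P ^ j * (α - ρ α)) := hz
      _ = exp (-(2 * (j : ℤ)) + -(dρ : ℤ)) := by rw [map_mul, map_pow, hPn, hαρ, ← exp_add]
  have hlt : Valued.v ((μ / Y - ρ (μ / Y)) * ν) < Valued.v (ρ (μ / Y) * (ν - ρ ν)) := by
    rw [hT2]
    refine lt_of_le_of_lt hT1 ?_
    rw [exp_lt_exp]; omega
  have hsum : Valued.v ((μ / Y - ρ (μ / Y)) * ν + ρ (μ / Y) * (ν - ρ ν)) = exp (-(m : ℤ) + 2 * b + -(jl : ℤ)) := by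
    rw [add_comm, Valuation.map_add_eq_of_lt_left _ hlt, hT2]
  -- the order's bound is violated
  rw [e, map_div₀, hsum, map_pow, hPn, ← exp_sub, map_mul, map_pow, hPn, hαρ, ← exp_add, exp_le_exp] at h2
  omega

/-! ## §2 HEADS — every glued vertex over such a cell fails the square token, hence is on no `(ℓ, M)` shell -/

/-- **HEAD, RamM LANE — «ABOVE THE ROW THE SQUARE TOKEN FAILS», LATTICE FORM (any `q`, any `d`).**  Frame: ★ `…ShellLineModel.latticeInLevel_endoGL_sub_one_sq_iff_isOrd`'s glued-vertex
letters VERBATIM (plane `E`, `|ϖ| = exp(−1)`, line model `(M, jE, ρ, α; φ, lam)` with `Fix ρ ⊇ jE(E)` (`hjfix`), vertex `L` with tube `b` over `(B₂, w₀, g₀)`, `Λ = φ(B₂) = x₀·𝒪_cc` with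
`cc = jE ϖ^j`, `φ w₀ = Y⁻¹x₀`) — but `jE` RAMIFIED: `hjϖ : |jE ϖ| = exp(−2)` and `hαρ : |α − ρα| = exp(−d_ρ)` replace lane B's `hjiso`, `|α − ρα| = 1`; the CELL's level
`hYb : |Y| = |jE ϖ|^b` and DEPTH CLAUSE `hz : IsOrd (jE ϖ^j) (μ∕Y)` (`μ := lam − jE u₀₀`); the KEY tokens of ‹OFF_C› `hm : |μ| = exp(−m)`, `hjl : |μ − ρμ| = exp(−jl)` (v_M units); the
smallness `hν : |(lam − 1) + (jE u₀₀ − 1)| ≤ |jE ϖ|^k`; and `htop : jl + m < 2j + d_ρ + 2b + 2k`.  THEN `¬ LatticeInLevel ϖ k ((Γ − 1)·(Γ − 1)) L`, `Γ = endoGL (γ₂, u)` — the square token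
at level `k` FAILS (its third clause is §1's digit, since `(lam − 1)² − (jE u₀₀ − 1)² = μ·ν`). [cite: Kottwitz1986BaseChangeUnits, §1 pp. 240–241] [cite: Serre1979, Ch. III §6 Prop. 12] [cite: Jacobowitz1962, §4] -/
theorem not_latticeInLevel_sq_endoGL_sub_one_of_top_ramM
    (hvρ : ∀ x, Valued.v (ρ x) = Valued.v x)
    {ϖ : E} (hϖ : Valued.v ϖ = exp (-1 : ℤ))
    (jE : E →+* M) (hjϖ : Valued.v (jE ϖ) = exp (-2 : ℤ)) (hjfix : ∀ z, ρ z = z ↔ ∃ c, jE c = z)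
    (φ : (Fin 2 → E) →+ M) (hφs : ∀ (c : E) (x : Fin 2 → E), φ (c • x) = jE c * φ x) (hφi : Function.Injective φ)
    {γ₂ : GL (Fin 2) E} {lam : M} (hφγ : ∀ x, φ ((γ₂ : Matrix (Fin 2) (Fin 2) E) *ᵥ x) = lam * φ x)
    {L : Submodule 𝒪[E] (Fin 3 → E)} {b : ℕ} (hb : ∀ a : E, (Pi.single 1 a : Fin 3 → E) ∈ L ↔ Valued.v a ≤ Valued.v ϖ ^ b)
    (hpr : ∀ x ∈ L, Valued.v (x 1) * Valued.v ϖ ^ b ≤ 1)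
    {B₂ : Submodule 𝒪[E] (Fin 2 → E)} {w₀ : Fin 2 → E} {g₀ : Fin 3 → E}
    (hB : B₂.map ((Matrix.toLin' (!![1, 0; 0, 0; 0, 1] : Matrix (Fin 3) (Fin 2) E)).restrictScalars 𝒪[E]) =
      L ⊓ LinearMap.ker ((LinearMap.proj (1 : Fin 3) : (Fin 3 → E) →ₗ[E] E).restrictScalars 𝒪[E]))
    (hg₀ : g₀ ∈ L) (hg₀1 : Valued.v (g₀ 1) * Valued.v ϖ ^ b = 1) (hprg : g₀ - Pi.single 1 (g₀ 1) = ![w₀ 0, 0, w₀ 1])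
    {Λ : AddSubgroup M} (hBΛ : B₂.toAddSubgroup.map φ = Λ) {x₀ Y : M} (hx₀ : x₀ ≠ 0) {j : ℕ}
    (hΛx : ∀ x, x ∈ Λ ↔ ∃ z, IsOrd ρ α (jE ϖ ^ j) z ∧ x = x₀ * z) (hw₀Y : φ w₀ = Y⁻¹ * x₀)
    (hYb : Valued.v Y = Valued.v (jE ϖ) ^ b)
    (u : GL (Fin 1) E) {m jl k dρ : ℕ}
    (hm : Valued.v (lam - jE ((u : Matrix (Fin 1) (Fin 1) E) 0 0)) = WithZero.exp (-(m : ℤ)))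
    (hjl : Valued.v ((lam - jE ((u : Matrix (Fin 1) (Fin 1) E) 0 0)) - ρ (lam - jE ((u : Matrix (Fin 1) (Fin 1) E) 0 0))) = WithZero.exp (-(jl : ℤ)))
    (hαρ : Valued.v (α - ρ α) = WithZero.exp (-(dρ : ℤ)))
    (hz : IsOrd ρ α (jE ϖ ^ j) ((lam - jE ((u : Matrix (Fin 1) (Fin 1) E) 0 0)) / Y))
    (hν : Valued.v ((lam - 1) + (jE ((u : Matrix (Fin 1) (Fin 1) E) 0 0) - 1)) ≤ Valued.v (jE ϖ) ^ k)
    (htop : jl + m < 2 * j + dρ + 2 * b + 2 * k) :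
    ¬ LatticeInLevel ϖ k (((((endoGL (γ₂, u) : GL (Fin 3) E) : Matrix (Fin 3) (Fin 3) E) - 1)) * ((((endoGL (γ₂, u) : GL (Fin 3) E) : Matrix (Fin 3) (Fin 3) E) - 1))) L := by
  have hvjϖ0 : Valued.v (jE ϖ) ≠ 0 := by rw [hjϖ]; exact exp_ne_zero
  have hY0 : Y ≠ 0 := fun h0 => by
    rw [h0, map_zero] at hYb
    exact pow_ne_zero b hvjϖ0 hYb.symm
  have hρϖ : ρ (jE ϖ) = jE ϖ := (hjfix _).2 ⟨ϖ, rfl⟩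
  have hρu : ρ (jE ((u : Matrix (Fin 1) (Fin 1) E) 0 0)) = jE ((u : Matrix (Fin 1) (Fin 1) E) 0 0) := (hjfix _).2 ⟨_, rfl⟩
  -- the third clause of the square token is §1's digit
  set μ : M := lam - jE ((u : Matrix (Fin 1) (Fin 1) E) 0 0) with hμdef
  set ν : M := (lam - 1) + (jE ((u : Matrix (Fin 1) (Fin 1) E) 0 0) - 1) with hνdef
  have hfac : (lam - 1) ^ 2 - (jE ((u : Matrix (Fin 1) (Fin 1) E) 0 0) - 1) ^ 2 = μ * ν := by rw [hμdef, hνdef]; ring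
  have hνρ : ν - ρ ν = μ - ρ μ := by
    simp only [hνdef, hμdef, map_add, map_sub, map_one, hρu]
    ring
  have hdigit := not_isOrd_mul_div_of_top_ramM hvρ hρϖ hjϖ hYb hm hjl hαρ ((isOrd_iff _ _ _ _).1 hz).2 hνρ hν htop
  intro hsq
  rw [latticeInLevel_endoGL_sub_one_sq_iff_isOrd hvρ hϖ jE φ hφs hφi hφγ hb hpr hB hg₀ hg₀1 hprg hBΛ hx₀ hY0 hΛx hw₀Y u k, hfac] at hsq
  exact hdigit hsq.2.2

/-- **HEAD, RamM LANE — «ABOVE THE ROW EVERY VERTEX IS OFF THE `(ℓ, k)` SHELL» (any `q`, any `d`, any `ℓ`).**  Same letters: `¬ LatticeNearTransvShell ϖ ℓ k (Γ − 1) L` for EVERY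
level `ℓ` (the shell's square clause is the token that fails).  In the (β₂) cell currency (`q₊` = shell `(ℓ₀, m⋆)` ∧ `VS = V₊`, `q₋′` = shell `(ℓ₀, m_c)` ∧ `¬ VS = V₊`, `m⋆ ≤ m_c`): on
the lane-C top line `jl + 2b = 2j + d_ρ + m` the digit's hypothesis reads `m < 2b + k`, so on the cells with `m < 2b + m⋆` BOTH labels are false on every glued vertex and the cell pays `0`.
[cite: Kottwitz1986BaseChangeUnits, §1 pp. 240–241] [cite: Rogawski1990, §4.9 Prop. 4.9.1 (b) p. 55] [cite: Serre1979, Ch. III §6 Prop. 12] -/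
theorem not_latticeNearTransvShell_of_top_ramM
    (hvρ : ∀ x, Valued.v (ρ x) = Valued.v x)
    {ϖ : E} (hϖ : Valued.v ϖ = exp (-1 : ℤ))
    (jE : E →+* M) (hjϖ : Valued.v (jE ϖ) = exp (-2 : ℤ)) (hjfix : ∀ z, ρ z = z ↔ ∃ c, jE c = z)
    (φ : (Fin 2 → E) →+ M) (hφs : ∀ (c : E) (x : Fin 2 → E), φ (c • x) = jE c * φ x) (hφi : Function.Injective φ)
    {γ₂ : GL (Fin 2) E} {lam : M} (hφγ : ∀ x, φ ((γ₂ : Matrix (Fin 2) (Fin 2) E) *ᵥ x) = lam * φ x)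
    {L : Submodule 𝒪[E] (Fin 3 → E)} {b : ℕ} (hb : ∀ a : E, (Pi.single 1 a : Fin 3 → E) ∈ L ↔ Valued.v a ≤ Valued.v ϖ ^ b)
    (hpr : ∀ x ∈ L, Valued.v (x 1) * Valued.v ϖ ^ b ≤ 1)
    {B₂ : Submodule 𝒪[E] (Fin 2 → E)} {w₀ : Fin 2 → E} {g₀ : Fin 3 → E}
    (hB : B₂.map ((Matrix.toLin' (!![1, 0; 0, 0; 0, 1] : Matrix (Fin 3) (Fin 2) E)).restrictScalars 𝒪[E]) =
      L ⊓ LinearMap.ker ((LinearMap.proj (1 : Fin 3) : (Fin 3 → E) →ₗ[E] E).restrictScalars 𝒪[E]))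
    (hg₀ : g₀ ∈ L) (hg₀1 : Valued.v (g₀ 1) * Valued.v ϖ ^ b = 1) (hprg : g₀ - Pi.single 1 (g₀ 1) = ![w₀ 0, 0, w₀ 1])
    {Λ : AddSubgroup M} (hBΛ : B₂.toAddSubgroup.map φ = Λ) {x₀ Y : M} (hx₀ : x₀ ≠ 0) {j : ℕ}
    (hΛx : ∀ x, x ∈ Λ ↔ ∃ z, IsOrd ρ α (jE ϖ ^ j) z ∧ x = x₀ * z) (hw₀Y : φ w₀ = Y⁻¹ * x₀)
    (hYb : Valued.v Y = Valued.v (jE ϖ) ^ b)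
    (u : GL (Fin 1) E) {m jl k dρ : ℕ}
    (hm : Valued.v (lam - jE ((u : Matrix (Fin 1) (Fin 1) E) 0 0)) = WithZero.exp (-(m : ℤ)))
    (hjl : Valued.v ((lam - jE ((u : Matrix (Fin 1) (Fin 1) E) 0 0)) - ρ (lam - jE ((u : Matrix (Fin 1) (Fin 1) E) 0 0))) = WithZero.exp (-(jl : ℤ)))
    (hαρ : Valued.v (α - ρ α) = WithZero.exp (-(dρ : ℤ)))
    (hz : IsOrd ρ α (jE ϖ ^ j) ((lam - jE ((u : Matrix (Fin 1) (Fin 1) E) 0 0)) / Y))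
    (hν : Valued.v ((lam - 1) + (jE ((u : Matrix (Fin 1) (Fin 1) E) 0 0) - 1)) ≤ Valued.v (jE ϖ) ^ k)
    (htop : jl + m < 2 * j + dρ + 2 * b + 2 * k) (ℓ : ℕ) :
    ¬ LatticeNearTransvShell ϖ ℓ k ((((endoGL (γ₂, u) : GL (Fin 3) E) : Matrix (Fin 3) (Fin 3) E) - 1)) L := fun h =>
  not_latticeInLevel_sq_endoGL_sub_one_of_top_ramM hvρ hϖ jE hjϖ hjfix φ hφs hφi hφγ hb hpr hB hg₀ hg₀1 hprg hBΛ hx₀ hΛx hw₀Y hYb u hm hjl hαρ hz hν htop h.2.2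

end Summit.HodgeConjecture.HodgeConjecture.Cruxes.H413.F0P3cDyRamTopConeCellOffShellRamM

end
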